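import Mathlib
import Literature.MathematicalPhysics.QuantumLattice.EuclideanAction

/-!
# Crux `IR` (stmt-QuantumFields-19354), line `af-pincer`, stub `stub_afOnsetUc : AFToOnsetUKPc` (X-side):
# Schwartz test functions supported in a half-space vanish to every order at its boundary, with Schwartz decay

Helper for the X-stub of slot `af-pincer-Uc` (seat ym-19354-afpincer-s2, generation 2).  The registered stub and cplan's
S2 done-when `AFBelowScaleAt` (HOME `ym-cplan-19354-af-pincer/Sketch-g10-sharp.lean`) pair the reflected test function
`θv` with `v`, `tsupport v ⊆ {y | 0 < y 0}`, inside BARE lattice sums `Q2 = Σ_{x,y} θv(s x) v(s y) Cov(A_x, A_y)`.  The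
scale-uniform control of such sums against a kernel `(1 + ‖x − y‖)⁻⁸` (the scale-invariant envelope of a dimension-4
density; file `…AfOnsetScaleSums`) needs the elementary fact proved here:

* `exists_abs_le_pow_div` — a Schwartz function `w` on `ℝ⁴` vanishing on the open half-space `{u | u 0 < 0}` satisfies,
  for every `k, M`, `|w u| ≤ C · |u 0|^k / (1 + ‖u‖)^M` (induction on `k`: the time-derivative `∂₀ w` is again such a
  function, and the mean value inequality along the segment from the boundary plane);
* `exists_abs_le_cube_div_of_tsupport` / `exists_abs_thetaTest_le_cube_div` — the instances used downstream: for
  `tsupport v ⊆ {y | 0 < y 0}`, both `v` and `θv = thetaTest 4 v` obey `|·(u)| ≤ C |u 0|³ / (1 + ‖u‖)^10`, `v` vanishes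
  where `u 0 ≤ 0` and `θv` where `0 ≤ u 0`.

HONEST FRAMING.  Elementary real analysis (folklore); nothing about Yang–Mills is asserted; one open stub of one open
gap-crux of a CONDITIONAL chain.
-/

set_option autoImplicit false

noncomputable section

open Filter Topology Set
open scoped SchwartzMap
open Literature.MathematicalPhysics.QuantumLattice

namespace Summit.QuantumFields.YangMills.Cruxes.IR.AfOnset

/-! ## §1 The time direction and Schwartz decay -/
section Time

/-- `‖e₀‖ = 1` for the unit vector `e₀ = EuclideanSpace.single 0 1` of the time axis of `ℝ⁴`. [folklore] -/
theorem norm_timeUnit : ‖(EuclideanSpace.single 0 1 : EuclideanSpace ℝ (Fin 4))‖ = 1 := by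
  simp

/-- Moving along the time axis changes only the time coordinate: `(u + t e₀) 0 = u 0 + t`. [folklore] -/
theorem add_smul_timeUnit_apply_zero (u : EuclideanSpace ℝ (Fin 4)) (t : ℝ) :
    (u + t • (EuclideanSpace.single 0 1 : EuclideanSpace ℝ (Fin 4))) 0 = u 0 + t := by
  simp

/-- **Schwartz decay of order `M`**: `|w u| ≤ C / (1 + ‖u‖)^M`. [folklore] -/
theorem exists_abs_le_div_pow (w : 𝓢(EuclideanSpace ℝ (Fin 4), ℝ)) (M : ℕ) :
    ∃ C : ℝ, 0 ≤ C ∧ ∀ u : EuclideanSpace ℝ (Fin 4), |w u| ≤ C / (1 + ‖u‖) ^ M := by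
  set C : ℝ := 2 ^ (M, 0).1 * (Finset.Iic (M, 0)).sup (fun m => SchwartzMap.seminorm ℝ m.1 m.2) w with hC
  refine ⟨C, by positivity, fun u => ?_⟩
  have h := SchwartzMap.one_add_le_sup_seminorm_apply (𝕜 := ℝ) (m := (M, 0)) (k := M) (n := 0) le_rfl le_rfl w u
  rw [norm_iteratedFDeriv_zero, Real.norm_eq_abs] at h
  rw [le_div_iff₀ (by positivity), mul_comm]
  exact h

end Time

/-! ## §2 Schwartz functions vanishing on the open lower half-space `{u | u 0 < 0}` -/
section Vanish

/-- The time derivative `∂₀ w` of a Schwartz function vanishing on `{u | u 0 < 0}` vanishes there as well. [folklore] -/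
theorem lineDerivOp_apply_eq_zero (w : 𝓢(EuclideanSpace ℝ (Fin 4), ℝ))
    (hw : ∀ u : EuclideanSpace ℝ (Fin 4), u 0 < 0 → w u = 0)
    (u : EuclideanSpace ℝ (Fin 4)) (hu : u 0 < 0) : LineDeriv.lineDerivOp (EuclideanSpace.single 0 1 : EuclideanSpace ℝ (Fin 4)) w u = 0 := by
  rw [SchwartzMap.lineDerivOp_apply, (w.differentiableAt).lineDeriv_eq_fderiv]
  have hopen : IsOpen {v : EuclideanSpace ℝ (Fin 4) | v 0 < 0} :=
    isOpen_lt (by fun_prop) continuous_const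
  have hev : (w : EuclideanSpace ℝ (Fin 4) → ℝ) =ᶠ[𝓝 u] fun _ => (0 : ℝ) :=
    Filter.eventuallyEq_of_mem (hopen.mem_nhds hu) fun v hv => hw v hv
  rw [hev.fderiv_eq]
  simp

/-- A Schwartz function vanishing on the open lower half-space vanishes on the closed one (continuity). [folklore] -/
theorem apply_eq_zero_of_le (w : 𝓢(EuclideanSpace ℝ (Fin 4), ℝ))
    (hw : ∀ u : EuclideanSpace ℝ (Fin 4), u 0 < 0 → w u = 0)
    (u : EuclideanSpace ℝ (Fin 4)) (hu : u 0 ≤ 0) : w u = 0 := by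
  rcases hu.lt_or_eq with hlt | heq
  · exact hw u hlt
  · -- approach `u` along the time axis from below
    set γ : ℝ → EuclideanSpace ℝ (Fin 4) := fun t => u + t • (EuclideanSpace.single 0 1 : EuclideanSpace ℝ (Fin 4)) with hγ
    have hcont : Continuous fun t => w (γ t) := w.continuous.comp (by simp only [hγ]; fun_prop)
    have h1 : Tendsto (fun t => w (γ t)) (𝓝[<] 0) (𝓝 (w (γ 0))) :=
      (hcont.tendsto 0).mono_left nhdsWithin_le_nhds
    have h2 : Tendsto (fun t => w (γ t)) (𝓝[<] 0) (𝓝 0) := by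
      refine tendsto_const_nhds.congr' ?_
      filter_upwards [self_mem_nhdsWithin] with t ht
      refine (hw (γ t) ?_).symm
      rw [hγ, add_smul_timeUnit_apply_zero, heq, zero_add]
      exact ht
    have h3 : w (γ 0) = 0 := tendsto_nhds_unique h1 h2
    simpa [hγ] using h3

/-- **Vanishing to every order at the boundary plane, with Schwartz decay.**  A Schwartz function `w` on `ℝ⁴` with
`w = 0` on `{u | u 0 < 0}` satisfies, for all `k, M`: `|w u| ≤ C · |u 0|^k / (1 + ‖u‖)^M` for some `C ≥ 0`.
Induction on `k`: `∂₀ w` is again such a function; along the segment `t ↦ u + (t − u 0) e₀`, `t ∈ [0, u 0]`, the mean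
value inequality and `1 + ‖u‖ ≤ (1 + ‖u + (t − u 0) e₀‖)(1 + u 0)` give the step for `u 0 ≤ 1`, plain decay for
`u 0 > 1`. [folklore] -/
theorem exists_abs_le_pow_div (k M : ℕ) :
    ∀ w : 𝓢(EuclideanSpace ℝ (Fin 4), ℝ), (∀ u : EuclideanSpace ℝ (Fin 4), u 0 < 0 → w u = 0) →
      ∃ C : ℝ, 0 ≤ C ∧ ∀ u : EuclideanSpace ℝ (Fin 4), |w u| ≤ C * |u 0| ^ k / (1 + ‖u‖) ^ M := by
  induction k with
  | zero =>
      intro w _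
      obtain ⟨C, hC0, hC⟩ := exists_abs_le_div_pow w M
      exact ⟨C, hC0, fun u => by simpa using hC u⟩
  | succ k ih =>
      intro w hw
      set w₁ : 𝓢(EuclideanSpace ℝ (Fin 4), ℝ) := LineDeriv.lineDerivOp (EuclideanSpace.single 0 1 : EuclideanSpace ℝ (Fin 4)) w with hw₁
      obtain ⟨C₁, hC₁0, hC₁⟩ := ih w₁ (lineDerivOp_apply_eq_zero w hw)
      obtain ⟨C₀, hC₀0, hC₀⟩ := exists_abs_le_div_pow w M
      refine ⟨2 ^ M * C₁ + C₀, by positivity, fun u => ?_⟩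
      have hden : 0 < (1 + ‖u‖) ^ M := by positivity
      by_cases hu : u 0 ≤ 0
      · rw [apply_eq_zero_of_le w hw u hu, abs_zero]
        positivity
      rw [not_le] at hu
      set τ : ℝ := u 0 with hτ
      -- the segment from the boundary plane to `u` along the time axis
      set γ : ℝ → EuclideanSpace ℝ (Fin 4) := fun t => u + (t - τ) • (EuclideanSpace.single 0 1 : EuclideanSpace ℝ (Fin 4)) with hγ
      have hγ0 : ∀ t, (γ t) 0 = t := by
        intro t
        rw [hγ]
        dsimp only
        rw [add_smul_timeUnit_apply_zero, ← hτ]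
        ring
      have hγτ : γ τ = u := by simp [hγ]
      have hγderiv : ∀ t, HasDerivAt γ (EuclideanSpace.single 0 1 : EuclideanSpace ℝ (Fin 4)) t := by
        intro t
        have h := ((hasDerivAt_id t).sub_const τ).smul_const (EuclideanSpace.single 0 1 : EuclideanSpace ℝ (Fin 4))
        simp only [one_smul] at h
        exact h.const_add u
      have hφderiv : ∀ t, HasDerivAt (fun t => w (γ t)) (w₁ (γ t)) t := by
        intro t
        have h := (w.differentiableAt (x := γ t)).hasFDerivAt.comp_hasDerivAt t (hγderiv t)
        rw [hw₁, SchwartzMap.lineDerivOp_apply, (w.differentiableAt).lineDeriv_eq_fderiv]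
        exact h
      -- norm comparison along the segment
      have hnorm : ∀ t ∈ Icc (0 : ℝ) τ, 1 + ‖u‖ ≤ (1 + ‖γ t‖) * (1 + τ) := by
        intro t ht
        have h1 : u = γ t - (t - τ) • (EuclideanSpace.single 0 1 : EuclideanSpace ℝ (Fin 4)) := by simp [hγ]
        have h2 : ‖u‖ ≤ ‖γ t‖ + ‖(t - τ) • (EuclideanSpace.single 0 1 : EuclideanSpace ℝ (Fin 4))‖ := by
          conv_lhs => rw [h1]
          exact norm_sub_le _ _
        have h3 : ‖(t - τ) • (EuclideanSpace.single 0 1 : EuclideanSpace ℝ (Fin 4))‖ ≤ τ := by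
          rw [norm_smul, norm_timeUnit, mul_one, Real.norm_eq_abs, abs_sub_comm, abs_of_nonneg (by linarith [ht.2])]
          linarith [ht.1]
        nlinarith [norm_nonneg (γ t), hu.le]
      -- the derivative bound on the segment
      set B : ℝ := C₁ * τ ^ k * (1 + τ) ^ M / (1 + ‖u‖) ^ M with hB
      have hBbound : ∀ t ∈ Ico (0 : ℝ) τ, ‖w₁ (γ t)‖ ≤ B := by
        intro t ht
        have ht' : t ∈ Icc (0 : ℝ) τ := Ico_subset_Icc_self ht
        rw [Real.norm_eq_abs]
        refine (hC₁ (γ t)).trans ?_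
        rw [hγ0 t, abs_of_nonneg ht.1, hB]
        have hpow : |t| ^ k ≤ τ ^ k := by
          rw [abs_of_nonneg ht.1]; exact pow_le_pow_left₀ ht.1 ht.2.le k
        have hγpos : 0 < (1 + ‖γ t‖) ^ M := by positivity
        rw [div_le_div_iff₀ hγpos hden]
        have hM : (1 + ‖u‖) ^ M ≤ (1 + ‖γ t‖) ^ M * (1 + τ) ^ M := by
          rw [← mul_pow]; exact pow_le_pow_left₀ (by positivity) (hnorm t ht') M
        calc C₁ * t ^ k * (1 + ‖u‖) ^ M ≤ C₁ * τ ^ k * ((1 + ‖γ t‖) ^ M * (1 + τ) ^ M) := by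
              rw [abs_of_nonneg ht.1] at hpow
              gcongr
          _ = C₁ * τ ^ k * (1 + τ) ^ M * (1 + ‖γ t‖) ^ M := by ring
      -- mean value inequality on `[0, τ]`
      have hmvt := norm_image_sub_le_of_norm_deriv_le_segment' (f := fun t => w (γ t))
        (f' := fun t => w₁ (γ t)) (fun t _ => (hφderiv t).hasDerivWithinAt) hBbound τ
        (right_mem_Icc.2 hu.le)
      have hγ00 : w (γ 0) = 0 := apply_eq_zero_of_le w hw (γ 0) (by rw [hγ0])
      rw [hγτ, hγ00, sub_zero, sub_zero, Real.norm_eq_abs] at hmvt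
      -- `|w u| ≤ B τ = C₁ τ^{k+1} (1+τ)^M / (1+‖u‖)^M`
      have hB0 : 0 ≤ B := by rw [hB]; positivity
      rw [abs_of_pos hu]
      by_cases hτ1 : τ ≤ 1
      · have h2M : (1 + τ) ^ M ≤ 2 ^ M := pow_le_pow_left₀ (by positivity) (by linarith) M
        calc |w u| ≤ B * τ := hmvt
          _ = C₁ * τ ^ (k + 1) * (1 + τ) ^ M / (1 + ‖u‖) ^ M := by rw [hB]; ring
          _ ≤ C₁ * τ ^ (k + 1) * 2 ^ M / (1 + ‖u‖) ^ M := by gcongr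
          _ = 2 ^ M * C₁ * τ ^ (k + 1) / (1 + ‖u‖) ^ M := by ring
          _ ≤ (2 ^ M * C₁ + C₀) * τ ^ (k + 1) / (1 + ‖u‖) ^ M := by gcongr; linarith
      · rw [not_le] at hτ1
        have hτk : 1 ≤ τ ^ (k + 1) := one_le_pow₀ hτ1.le
        calc |w u| ≤ C₀ / (1 + ‖u‖) ^ M := hC₀ u
          _ ≤ C₀ * τ ^ (k + 1) / (1 + ‖u‖) ^ M := by
              gcongr
              exact le_mul_of_one_le_right hC₀0 hτk
          _ ≤ (2 ^ M * C₁ + C₀) * τ ^ (k + 1) / (1 + ‖u‖) ^ M := by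
              gcongr
              nlinarith [pow_pos (show (0:ℝ) < 2 from two_pos) M]

end Vanish

/-! ## §3 The instances used by the X-stub: `v` with `tsupport v ⊆ {y | 0 < y 0}` and its time reflection `θv` -/
section Instances

/-- A test function supported at positive times vanishes on `{u | u 0 ≤ 0}`. [folklore] -/
theorem apply_eq_zero_of_tsupport_subset (v : 𝓢(EuclideanSpace ℝ (Fin 4), ℝ))
    (hv : tsupport v ⊆ {y : EuclideanSpace ℝ (Fin 4) | 0 < y 0}) (u : EuclideanSpace ℝ (Fin 4)) (hu : u 0 ≤ 0) :
    v u = 0 := by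
  by_contra h
  have hmem : u ∈ tsupport v := subset_tsupport _ (Function.mem_support.2 h)
  exact absurd (hv hmem) (not_lt.2 hu)

/-- The time reflection of a test function supported at positive times vanishes on `{u | 0 ≤ u 0}`. [folklore] -/
theorem thetaTest_apply_eq_zero_of_tsupport_subset (v : 𝓢(EuclideanSpace ℝ (Fin 4), ℝ))
    (hv : tsupport v ⊆ {y : EuclideanSpace ℝ (Fin 4) | 0 < y 0}) (u : EuclideanSpace ℝ (Fin 4)) (hu : 0 ≤ u 0) :
    thetaTest 4 v u = 0 := by
  rw [thetaTest_apply]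
  refine apply_eq_zero_of_tsupport_subset v hv _ ?_
  have h0 : (timeReflection 4 u) 0 = -u 0 := by simp
  rw [h0]
  linarith

/-- **Cubic vanishing with decay of order 10 for `v`**: `|v u| ≤ C |u 0|³ / (1 + ‖u‖)^10`. [folklore] -/
theorem exists_abs_le_cube_div_of_tsupport (v : 𝓢(EuclideanSpace ℝ (Fin 4), ℝ))
    (hv : tsupport v ⊆ {y : EuclideanSpace ℝ (Fin 4) | 0 < y 0}) :
    ∃ C : ℝ, 0 ≤ C ∧ ∀ u : EuclideanSpace ℝ (Fin 4), |v u| ≤ C * |u 0| ^ 3 / (1 + ‖u‖) ^ 10 :=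
  exists_abs_le_pow_div 3 10 v fun u hu => apply_eq_zero_of_tsupport_subset v hv u hu.le

/-- **Cubic vanishing with decay of order 10 for `θv`**: `|θv u| ≤ C |u 0|³ / (1 + ‖u‖)^10` (`θ` is an isometry
flipping the sign of the time coordinate). [folklore] -/
theorem exists_abs_thetaTest_le_cube_div (v : 𝓢(EuclideanSpace ℝ (Fin 4), ℝ))
    (hv : tsupport v ⊆ {y : EuclideanSpace ℝ (Fin 4) | 0 < y 0}) :
    ∃ C : ℝ, 0 ≤ C ∧ ∀ u : EuclideanSpace ℝ (Fin 4), |thetaTest 4 v u| ≤ C * |u 0| ^ 3 / (1 + ‖u‖) ^ 10 := by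
  obtain ⟨C, hC0, hC⟩ := exists_abs_le_cube_div_of_tsupport v hv
  refine ⟨C, hC0, fun u => ?_⟩
  have h := hC (timeReflection 4 u)
  rw [thetaTest_apply]
  have h0 : (timeReflection 4 u) 0 = -u 0 := by simp
  rwa [h0, abs_neg, (timeReflection 4).norm_map] at h

end Instances

end Summit.QuantumFields.YangMills.Cruxes.IR.AfOnset

end
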